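/-
Copyright (c) 2026 the pub-hodgecm-mathlib formalisation cell (harness21).  Prover seat hodgecm-mathlib-K2E1-p13 (g3) acting as R90-CS-p04∕p05 (R90-TF section S8 «ContSpec-n½»,
planner R90-CS-plan (g0), LEAD K2E1-plan (g7) #15): the FIRST ★-closable fragment named by the census `R90/S8/ROAD-S8B2.K2E1-p13-g3.md` — THE AUTOMORPHIC CHARACTER LINES ARE RESIDUAL,
for every adelic group datum (hypothesis-first on «cusp forms have mean zero») and LETTER-FREE for the quasi-split `U(Φ₂)`, `U(Φ₃)` of a CM field (sockets S8B#5, S8B#1 of file B).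
-/
import Summits.HodgeConjecture.HodgeConjecture.Theorems.K2E1ResidualCharacterVectorsU2   -- ★ `span_toLp_le_residualSubspace` (generic), `hmean_cm_twoR`; brings ★ `K2E1CuspFormsMeanZeroSoftUCM.hmean_cm_threeR`, ★ `…UnitaryDefsR` (`cmParabolicDataR`, `cmResidualSubspaceR`), ★ `standardUnipotentRadical_le_upperUnitriangular`
import Literature.NumberTheory.Automorphic.AutomorphicCharacterLine                       -- ★ `AutomorphicCharacter.lineSubrep`, `lineSubrep_toSubmodule`, `toL2`
import Literature.NumberTheory.Automorphic.UnitaryGroupDetCharacter                       -- ★ `cmDetChar` (`ψ ∘ det`), `cmDetChar_apply`, `coe_adelicDet`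
import Literature.NumberTheory.Automorphic.LocalUnitaryGroupCongr                         -- ★ `isUnit_antidiagOne_det` (`Φ_N` invertible)
import Literature.NumberTheory.Automorphic.MahlerCriterionPrelims                         -- ★ `Mahler.det_eq_one_of_mem_upperUnitriangular`
import HarnessLib

/-!
# R90·S8 — `R90S8CharLineResidual`: THE LINE `ℂ·[ψ]` OF AN AUTOMORPHIC CHARACTER TRIVIAL ON THE UNIPOTENT RADICALS LIES IN `L²_res = L²_disc ⊓ (L²_cusp)ᗮ`; for the quasi-split
# `U(Φ_N)` of a CM field the lines `ℂ·[ψ ∘ det]` lie in `cmResidualSubspaceR L N μ` — letter-free at `N = 2` (S8B#5) and `N = 3` (S8B#1) [Rogawski1990 §13.9 (i); MW95 I.2.18]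

Cell `pub/hodgecm-mathlib`, crux h413 = `stmt-HodgeConjecture-24833`, route of record `HCCMUnconditional`; R90-TF section S8, deal sheet `R90/S8/DEAL-S8-WAVE1.R90-CS-plan-g0.md`
(hands p04 census → p05 first fragment), census `R90/S8/ROAD-S8B2.K2E1-p13-g3.md` §4.  THEOREMS ONLY (no `def`, no `instance`, no notation, no named-fact hypothesis, no `sorry`);
lane `--supports stmt-HodgeConjecture-24833 --as helper` (count-neutral).  Namespace: the Theorems lint mandates the module namespace `…Cruxes.H413.R90S8CharLineResidual` (the deal's
`…R90.S8` is for the `Lines/` statement files).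

THE MATHEMATICS ([Rogawski1990, §13.9 (i) p. 229; Prop. 13.6.2 (1) p. 210]; [MoeglinWaldspurger1995, I.2.18]).  Let `ψ : G(𝔸) → ℂˣ` be a continuous unitary character trivial on
`A_G·G(F)` (★ `AutomorphicCharacter`) and on every unipotent radical `N_i(𝔸)` of the parabolic datum `𝔓`.  Its `L²`-class `[ψ̄]` spans a closed invariant irreducible LINE (★
`lineSubrep`, `isTopIrreducible_lineSubrep`), hence `≤ L²_disc`; and `[ψ̄] ⟂ L²_cusp`: for a cusp form `φ`, `φ·ψ̄⁻¹`… — precisely ★ `K2E1ResidualCharacterVectorsU2.span_toLp_le_residualSubspace`: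
`ψ̄·φ` is again a cusp form (`ψ̄` is constant along the `N_i`-fibres), so `⟪[ψ̄], φ⟫ = ∫ conj(ψ̄)φ = conj ∫ ψ̄·conj… = 0` as soon as CUSP FORMS HAVE MEAN ZERO (`hmean`) — and `hmean` is ★ at
`U(Φ₂)` (`hmean_cm_twoR`) and at `U(Φ₃)` along the full Heisenberg radical (`hmean_cm_threeR`).  For `ψ ∘ det` (★ `cmDetChar`) triviality on the radicals is `det u = 1` for `u` upper
unitriangular (★ `standardUnipotentRadical_le_upperUnitriangular`, ★ `Mahler.det_eq_one_of_mem_upperUnitriangular`).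
* §1 (generic `𝒢`) **`lineSubrep_le_residualSubspace`** — `hmean`-first.
* §2 (CM, any `N`) `flagUnipotentRadical_le_upperUnitriangular`, `cmDetChar_eq_one_of_mem_radical` (`ψ∘det = 1` on every `N_{P_k}(𝔸_{L⁺})`).
* §3 (CM, `N = 2`, `N = 3`, LETTER-FREE) **`lineSubrep_le_cmResidualSubspaceR_two∕three`** (any automorphic character trivial on the radicals) and the prints
  **`cmDetChar_lineSubrep_le_cmResidualSubspaceR_two`** (= S8B#5) ∕ **`…_three`** (= S8B#1): `ℂ·[ψ∘det] ≤ L²_res(U(Φ_N))`.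
HONEST LABEL: HC_CM is proved only modulo the 7 printed citations (2 remaining named inputs: hLiu418 = `stmt-HodgeConjecture-24832`, h413 = `stmt-HodgeConjecture-24833`) until rung 0
closes; REL ≠ ★ ≠ BUILT; count-neutral helper; closes no socket by itself (S8B#5∕#1 close when file B is WRITTEN and its statements are these bytes or one `exact` away).

## References
* [Rogawski1990] J. D. Rogawski, *Automorphic Representations of Unitary Groups in Three Variables* (1990): §13.9 (i) p. 229, Prop. 13.6.2 (1) p. 210, §13.3 p. 202 (`χ∘det`).
* [MoeglinWaldspurger1995] C. Mœglin, J.-L. Waldspurger, *Spectral Decomposition and Eisenstein Series* (1995): I.2.18 (residual characters of rank-one groups).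
* [BorelJacquet1979] A. Borel, H. Jacquet, *Automorphic forms and automorphic representations*, Corvallis (1979): §4.4–§4.6.
-/

set_option autoImplicit false
set_option linter.dupNamespace false  -- the mandated namespace repeats the summit's segment (`HodgeConjecture.HodgeConjecture`)

noncomputable section

open MeasureTheory NumberField
open scoped InnerProductSpace
open Literature.NumberTheory.Automorphic Literature.NumberTheory.Automorphic.UnitaryGroup
open Literature.NumberTheory.Automorphic.Arthur2013.Leaves.TECR
open Summit.HodgeConjecture.HodgeConjecture.Cruxes.H413.K2E1CuspidalSpectrumUnitary
open Summit.HodgeConjecture.HodgeConjecture.Cruxes.H413.K2E1ResidualCharacterVectorsU2 (span_toLp_le_residualSubspace hmean_cm_twoR)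
open Summit.HodgeConjecture.HodgeConjecture.Cruxes.H413.K2E1CuspFormsMeanZeroSoftUCM (hmean_cm_threeR)
open Summit.HodgeConjecture.HodgeConjecture.Cruxes.H413.K2E1HeisenbergRadicalCocompactU3 (standardUnipotentRadical_le_upperUnitriangular)

namespace Summit.HodgeConjecture.HodgeConjecture.Cruxes.H413.R90S8CharLineResidual

universe u

/-! ## §1 Generic: the line of an automorphic character trivial on the radicals is residual, modulo «cusp forms have mean zero» -/

section Generic

variable {K : Type} [Field K] [NumberField K] (𝒢 : AdelicGroupData.{u} K) (μ : Measure 𝒢.automorphicQuotient) [𝒢.IsAutomorphicMeasure μ]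

/-- **`ℂ·[ψ̄] ≤ L²_res = L²_disc ⊓ (L²_cusp)ᗮ`** for every unitary automorphic character `ψ` of `G(𝔸)` trivial on each unipotent radical of `𝔓`, as soon as the cusp forms along `𝔓` have mean
zero (★ `span_toLp_le_residualSubspace` at `ω := ψ̄`, multiplier `c := ψ`; ★ `lineSubrep_toSubmodule`). [cite: MoeglinWaldspurger1995, I.2.18] [cite: Rogawski1990, §13.9 (i) p. 229] -/
theorem lineSubrep_le_residualSubspace (𝔓 : 𝒢.ParabolicUnipotentData) (hmean : ∀ φ ∈ 𝒢.cuspForms μ 𝔓, ∫ x, φ x ∂μ = 0)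
    (ψ : 𝒢.AutomorphicCharacter) (hψN : ∀ (i : 𝔓.ι) (u : 𝔓.radical i), ψ (u : 𝒢.Adelic) = 1) :
    (ψ.lineSubrep μ).toSubmodule ≤ (residualSubspace 𝒢 μ 𝔓).toSubmodule := by
  rw [AdelicGroupData.AutomorphicCharacter.lineSubrep_toSubmodule]
  exact span_toLp_le_residualSubspace 𝒢 μ 𝔓 hmean ψ.continuous_quotientFun ψ.norm_quotientFun (c := fun g => ((ψ g : ℂˣ) : ℂ)) ψ.quotientFun_smul
    (fun i x u => by
      rw [AdelicGroupData.AutomorphicCharacter.quotientFun_toAutomorphicQuotient, AdelicGroupData.AutomorphicCharacter.quotientFun_toAutomorphicQuotient,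
        map_mul, map_inv, hψN, inv_one, mul_one])
    (ψ.memLp_quotientFun μ)

end Generic

/-! ## §2 CM: `ψ ∘ det` is trivial on the unipotent radicals `N_{P_k}(𝔸_{L⁺})` of `U(Φ_N)` -/

section CM

variable (L : Type) [Field L] [NumberField L] [IsCMField L]

/-- `R_u(P_{(k, n−2k, k)}) = N_k ⊔ N_{n−k}` consists of upper unitriangular matrices (★ `standardUnipotentRadical_le_upperUnitriangular` twice). [cite: BorelJacquet1979, §4.4] -/
theorem flagUnipotentRadical_le_upperUnitriangular (n k : ℕ) (R : Type*) [CommRing R] : flagUnipotentRadical n k R ≤ upperUnitriangular (Fin n) R :=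
  sup_le (standardUnipotentRadical_le_upperUnitriangular n k R) (standardUnipotentRadical_le_upperUnitriangular n (n - k) R)

/-- **`(ψ∘det)(u) = 1` ON EVERY PRINTED RADICAL `N_{P_k}(𝔸_{L⁺})` OF `U(Φ_N)`** (`det u = 1` for upper unitriangular `u`, ★ `Mahler.det_eq_one_of_mem_upperUnitriangular`).
[cite: Rogawski1990, §13.3 p. 202] [cite: BorelJacquet1979, §4.4] -/
theorem cmDetChar_eq_one_of_mem_radical (N : ℕ) (ψ : ↥(TorusDict.torus (IsCMField.complexConj L)) →ₜ* ℂˣ) (hψ : TorusDict.IsAutomorphic (IsCMField.complexConj L) ψ)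
    (k : (cmParabolicDataR L N).ι) (u : (UnitaryGroup.cmDatum L N (Matrix.of fun i j : Fin N => if i.val + j.val + 1 = N then (1 : L) else 0)).Adelic) (hu : u ∈ (cmParabolicDataR L N).radical k) :
    (cmDetChar L N (Matrix.of fun i j : Fin N => if i.val + j.val + 1 = N then (1 : L) else 0) ψ hψ (isUnit_antidiagOne_det L N).ne_zero : (UnitaryGroup.cmDatum L N (Matrix.of fun i j : Fin N => if i.val + j.val + 1 = N then (1 : L) else 0)).AutomorphicCharacter) u = 1 := by
  have hdet : adelicDet (↥(maximalRealSubfield L)) L (IsCMField.complexConj L) N (Matrix.of fun i j : Fin N => if i.val + j.val + 1 = N then (1 : L) else 0) (isUnit_antidiagOne_det L N).ne_zero u = 1 := by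
    refine Subtype.ext ?_
    rw [coe_adelicDet, OneMemClass.coe_one]
    exact Mahler.det_eq_one_of_mem_upperUnitriangular (flagUnipotentRadical_le_upperUnitriangular N k.1 _ ((mem_cmUnipotentRadicalR_iff L N k.1 u).1 hu))
  show cmDetChar L N (Matrix.of fun i j : Fin N => if i.val + j.val + 1 = N then (1 : L) else 0) ψ hψ (isUnit_antidiagOne_det L N).ne_zero u = 1
  rw [cmDetChar_apply, hdet, map_one, map_one]

/-! ## §3 The letter-free prints at `N = 2` (S8B#5) and `N = 3` (S8B#1) -/

/-- **`U(Φ₂)`: the line of ANY automorphic character trivial on the Siegel radical is residual**, letter-free (`hmean` ★ `hmean_cm_twoR`). [cite: MoeglinWaldspurger1995, I.2.18] -/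
theorem lineSubrep_le_cmResidualSubspaceR_two (μ : Measure (UnitaryGroup.cmDatum L 2 (Matrix.of fun i j : Fin 2 => if i.val + j.val + 1 = 2 then (1 : L) else 0)).automorphicQuotient) [(UnitaryGroup.cmDatum L 2 (Matrix.of fun i j : Fin 2 => if i.val + j.val + 1 = 2 then (1 : L) else 0)).IsAutomorphicMeasure μ]
    (ψ : (UnitaryGroup.cmDatum L 2 (Matrix.of fun i j : Fin 2 => if i.val + j.val + 1 = 2 then (1 : L) else 0)).AutomorphicCharacter) (hψN : ∀ (k : (cmParabolicDataR L 2).ι) (u : (cmParabolicDataR L 2).radical k), ψ (u : (UnitaryGroup.cmDatum L 2 (Matrix.of fun i j : Fin 2 => if i.val + j.val + 1 = 2 then (1 : L) else 0)).Adelic) = 1) :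
    (ψ.lineSubrep μ).toSubmodule ≤ (cmResidualSubspaceR L 2 μ).toSubmodule :=
  lineSubrep_le_residualSubspace _ μ (cmParabolicDataR L 2) (hmean_cm_twoR L μ) ψ hψN

/-- **`U(Φ₃)`: the line of ANY automorphic character trivial on the Heisenberg radical is residual**, letter-free (`hmean` ★ `hmean_cm_threeR`). [cite: MoeglinWaldspurger1995, I.2.18] -/
theorem lineSubrep_le_cmResidualSubspaceR_three (μ : Measure (UnitaryGroup.cmDatum L 3 (Matrix.of fun i j : Fin 3 => if i.val + j.val + 1 = 3 then (1 : L) else 0)).automorphicQuotient) [(UnitaryGroup.cmDatum L 3 (Matrix.of fun i j : Fin 3 => if i.val + j.val + 1 = 3 then (1 : L) else 0)).IsAutomorphicMeasure μ]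
    (ψ : (UnitaryGroup.cmDatum L 3 (Matrix.of fun i j : Fin 3 => if i.val + j.val + 1 = 3 then (1 : L) else 0)).AutomorphicCharacter) (hψN : ∀ (k : (cmParabolicDataR L 3).ι) (u : (cmParabolicDataR L 3).radical k), ψ (u : (UnitaryGroup.cmDatum L 3 (Matrix.of fun i j : Fin 3 => if i.val + j.val + 1 = 3 then (1 : L) else 0)).Adelic) = 1) :
    (ψ.lineSubrep μ).toSubmodule ≤ (cmResidualSubspaceR L 3 μ).toSubmodule :=
  lineSubrep_le_residualSubspace _ μ (cmParabolicDataR L 3) (hmean_cm_threeR L μ) ψ hψN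

/-- **S8B#5 — `ℂ·[ψ∘det] ≤ L²_res(U(Φ₂)_{L∕L⁺})`** for every automorphic character `ψ` of `U(1)_{L∕L⁺}(𝔸)` (★ `cmDetChar`), LETTER-FREE: the residual spectrum of the quasi-split `U(1,1)`
contains every character line — the `N = 2` side of [Rogawski1990, §13.9 (i)] ∕ Langlands' rank-one residual characters. [cite: Rogawski1990, §13.9 (i) p. 229] [cite: MoeglinWaldspurger1995, I.2.18] -/
theorem cmDetChar_lineSubrep_le_cmResidualSubspaceR_two (μ : Measure (UnitaryGroup.cmDatum L 2 (Matrix.of fun i j : Fin 2 => if i.val + j.val + 1 = 2 then (1 : L) else 0)).automorphicQuotient) [(UnitaryGroup.cmDatum L 2 (Matrix.of fun i j : Fin 2 => if i.val + j.val + 1 = 2 then (1 : L) else 0)).IsAutomorphicMeasure μ]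
    (ψ : ↥(TorusDict.torus (IsCMField.complexConj L)) →ₜ* ℂˣ) (hψ : TorusDict.IsAutomorphic (IsCMField.complexConj L) ψ) :
    (AdelicGroupData.AutomorphicCharacter.lineSubrep (𝒢 := (UnitaryGroup.cmDatum L 2 (Matrix.of fun i j : Fin 2 => if i.val + j.val + 1 = 2 then (1 : L) else 0))) (cmDetChar L 2 (Matrix.of fun i j : Fin 2 => if i.val + j.val + 1 = 2 then (1 : L) else 0) ψ hψ (isUnit_antidiagOne_det L 2).ne_zero) μ).toSubmodule ≤ (cmResidualSubspaceR L 2 μ).toSubmodule :=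
  lineSubrep_le_cmResidualSubspaceR_two L μ _ fun k u => cmDetChar_eq_one_of_mem_radical L 2 ψ hψ k u u.2

/-- **S8B#1 — `ℂ·[ψ∘det] ≤ L²_res(U(Φ₃)_{L∕L⁺})`** for every automorphic character `ψ` of `U(1)_{L∕L⁺}(𝔸)`, LETTER-FREE: case (i) of [Rogawski1990, §13.9] («π is the one-dimensional
representation defined by the character ψ∘det_G of G\G») is IN the residual spectrum — the easy inclusion of the classification S8B#2. [cite: Rogawski1990, §13.9 (i) p. 229] [cite: MoeglinWaldspurger1995, I.2.18] -/
theorem cmDetChar_lineSubrep_le_cmResidualSubspaceR_three (μ : Measure (UnitaryGroup.cmDatum L 3 (Matrix.of fun i j : Fin 3 => if i.val + j.val + 1 = 3 then (1 : L) else 0)).automorphicQuotient) [(UnitaryGroup.cmDatum L 3 (Matrix.of fun i j : Fin 3 => if i.val + j.val + 1 = 3 then (1 : L) else 0)).IsAutomorphicMeasure μ]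
    (ψ : ↥(TorusDict.torus (IsCMField.complexConj L)) →ₜ* ℂˣ) (hψ : TorusDict.IsAutomorphic (IsCMField.complexConj L) ψ) :
    (AdelicGroupData.AutomorphicCharacter.lineSubrep (𝒢 := (UnitaryGroup.cmDatum L 3 (Matrix.of fun i j : Fin 3 => if i.val + j.val + 1 = 3 then (1 : L) else 0))) (cmDetChar L 3 (Matrix.of fun i j : Fin 3 => if i.val + j.val + 1 = 3 then (1 : L) else 0) ψ hψ (isUnit_antidiagOne_det L 3).ne_zero) μ).toSubmodule ≤ (cmResidualSubspaceR L 3 μ).toSubmodule :=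
  lineSubrep_le_cmResidualSubspaceR_three L μ _ fun k u => cmDetChar_eq_one_of_mem_radical L 3 ψ hψ k u u.2

end CM

end Summit.HodgeConjecture.HodgeConjecture.Cruxes.H413.R90S8CharLineResidual

end
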